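import Summits.BirchSwinnertonDyer.BirchSwinnertonDyer.Theorems.KatoDescentPotSupersingularWildFineSelmerLayerOneL5Records11
import Summits.BirchSwinnertonDyer.BirchSwinnertonDyer.Theorems.KatoDescentPotSupersingularWildConjAResidueCartanRows11
import Summits.BirchSwinnertonDyer.BirchSwinnertonDyer.Theorems.KatoDescentPotSupersingularWildUpperUnitTwistRecordsSharp22
import Summits.BirchSwinnertonDyer.BirchSwinnertonDyer.Theorems.KatoDescentPotSupersingularWildUpperUnitTwistRecordsSharpP29
import Summits.BirchSwinnertonDyer.BirchSwinnertonDyer.Theorems.KatoDescentPotSupersingularWildUpperUnitTwistRecordsClassO609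
import Summits.BirchSwinnertonDyer.BirchSwinnertonDyer.Theorems.KatoDescentPotSupersingularWildUpperUnitTwistRecordsFlat23
import Summits.BirchSwinnertonDyer.BirchSwinnertonDyer.Theorems.KatoDescentTamePotSupersingularCartanMuRoadFukudaDoorsTprime
import Literature.NumberTheory.EllipticCurves.FineSelmerCentralLayerDoors
import Literature.NumberTheory.EllipticCurves.ModThreeImageCubeDiscriminantProofs
import HarnessLib

/-!
# Route `KatoDescentPotSupersingular` (rung K9, sub-rung B5 = O6 wild `p = 3`, cell `bsd-potss`): per-row records on the FACT-FREE door L11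
# (ONE-LAYER CENTRAL CRITERION at the torsion-point field `ℚ(P)`): statement (A) of Coates–Sujatha at `(E, 3)` with NO named fact, and U₀ modulo
# `hKatoA hGZK hmod`, for the K9 Conj-A residue rows 406593q1, 406593f1, 406593n1, 223587bz1, 223587k1
# (literature seat `bsd-potss-conjA-anchor` g21; road = `CoatesSujatha2005.conjA_of_classGroup_mulEquiv_trivial_stabilizerField_succ` (door L11 ∘ L8,
# `Literature/NumberTheory/EllipticCurves/FineSelmerCentralLayerDoors`); `--supports stmt-BirchSwinnertonDyer-19386 --as helper`)

HONEST FRAMING. THEOREMS ONLY (no definition, no named fact, no `sorry`); PER ROW — NOT a class theorem; nothing is booked; items 19386 / 19942 /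
19189 / 19197 stay OPEN at class level; Conjecture A and BSD are proved for NO class of curves.  Each theorem is CONDITIONAL on ONE displayed numerical
hypothesis about ONE degree-24 number field with its Galois action (GRH class-group computation), which is NOT certified in the kernel.

ROAD (doors L8 (conjA-anchor g19) ∘ L11 (conjA-anchor g21), all KERNEL theorems; `p = 3`, `n₀ = 0`, `j = 1`): `E[3]` irreducible (kernel `irr_g…_3`) and `Δ(E)`
a CUBE (kernel `Δ_eq_cube_g…` / `Δ_cube_g…`) ⟹ `ρ̄_{E,3}` not onto (`ModThreeImage.not_hasSurjectiveModNGaloisRep_three_of_Δ_eq_cube`) ⟹ `3 ∤ #Gal(ℚ(E[3])/ℚ)`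
(Serre Prop. 15, `SmallImageDickson.not_dvd_card_aut_divisionField`) ⟹ (tameness for door L8, and) the cyclotomic `ℤ₃`-extension of `ℚ(P) = ℚ̄^{Stab(P)} ⊆ ℚ(E[3])`
(`CoatesSujatha2005.fixedField_stabilizer_le_divisionField`) has Fukuda index `0` (`CartanMuRoadFukudaDoorsTprime.totallyRamifiedFrom_zero_of_isCyclotomic_of_algHom_normal_of_not_dvd_card`)
— all in the KERNEL; plus ONE DISPLAYED hypothesis `hσ`: **for every non-zero `P ∈ E[3]` and every cyclotomic `ℤ₃`-extension `κ_P` of `ℚ(P)`, every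
`ℚ(P)`-automorphism of the first layer `ℚ(P)₁ = ℚ(P)·ℚ(ζ₉)⁺` acts trivially on `Cl(ℚ(P)₁)/Cl(ℚ(P)₁)³`** ⟹ (door L11, `IwasawaTheory.classicalMuVanishes_of_classGroup_mulEquiv_trivial_succ`)
the `3`-ranks along the tower are bounded and `μ₃(ℚ(P)_cyc) = 0` ⟹ (door L8, `fineSelmerDual_moduleFinite_of_classGroupPRank_stabilizerField_le`) statement (A) at `(E, 3)`
for every cyclotomic `ℤ₃`-extension of `ℚ` (`conjA_g…_3_L11`); and U₀ `MissingUpperBoundAt E 3` modulo the named facts `hKatoA hGZK hmod` + Cremona's `r_an = 0`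
(`missingUpperBoundAt_g…_3_L11`, via k8t-c4's `WildFineSelmerSupersingularCMAnchor.missingUpperBoundAt_wild_of_conjA`).  NO `μ`-hypothesis, NO Ferrero–Washington, NO Fukuda /
Iwasawa-growth / Coates–Sujatha fact, NO anchor curve, NO bound on a class number: the rows `Cl(ℚ(P)₁)[3] ≅ [3,3]` (rank `2`) are exactly where door L10
(`rank₃ ≤ 1`, conjA-anchor g20) and Fukuda's two-layer test (`e₀ = 0 ≠ 2 = e₁`) are silent.
NUMERICS (conjA-anchor g20, kit j329384 = v2 of j329182, PARI/GP 2.17, `bnfinit` flag 0, GRH, no `bnfcertify`; RESULT file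
`run/shared/lean/pub/bsd-potss/conjA-anchor/g20/kit/l11pre/RESULT-l11pre-v2-j329384.txt`): for the octic `K8 = x^8 - 2x^7 + 2x^6 + 8x^5 - 33x^4 + 75x^3 - 126x^2 + 99x - 27`
(= `ℚ(P)` of 406593q1 / f1 / n1 per the cell's census, conjA-anchor g19/g20) the layer `F1 = K8·ℚ(ζ₉)⁺` (degree 24) has `h = 9`, `Cl = [3,3]` and the generator `σ` of
`Gal(F1/K8)` acts as the IDENTITY on `Cl/3`; for the octic `K8 = x^8 - 12x^6 - 91x^5 - 219x^4 - 273x^3 - 108x^2 + 81` (= `ℚ(P)` of 223587bz1 / k1) `F1` has `h = 54`,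
`Cl = [6,3,3]`, `σ` = identity on `Cl/3`.  The identification of the Lean field `fixedField (Stab P)` with `ℚ[x]/(K8)` is the census memos' (all `ℚ(P)`, `P ≠ 0`, are
conjugate: the image `C_ns⁺(3)` is transitive on `E[3] ∖ 0`), not a kernel statement; `Gal(F1/K8) = ⟨σ⟩` has order `3`, so «`σ` trivial» = «every automorphism trivial».
KERNEL lemmas `isElliptic_g…`, `isGloballyMinimal_g…`, `irr_g…_3`, `classO6_g…_3`, `Δ_eq_cube_g406593q1`, `Δ_cube_g406593n1` are IMPORTED (k9-c4 g16–g25 / k8t-c4 files,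
namespaces `…Theorems.WildUpperUnitTwistRecords`, `…Theorems.WildFineSelmerLayerOneL5Records`); `Δ_cube_g406593f1`, `Δ_cube_g223587bz1`, `Δ_cube_g223587k1` are proved here (`norm_num`).

References: [CoatesSujatha2005] Thm. 3.4, Lemma 3.8; [DeoRaySujatha2023] §5 Lemma 5.1; [Washington1997] §13.3 Lemma 13.18, Prop. 13.22–13.23; [Fukuda1994] Thm. 1 (proof,
p. 264); [NeukirchANT1999] Ch. IV §6, Ch. VI §7 Thm. (7.1); [Serre1972] §2.4 Prop. 15, §5.3; [Kato2004Asterisque] Thm. 14.5 (3), Prop. 14.16 (2); [Cremona2006] Table 1.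
-/

set_option autoImplicit false
set_option linter.dupNamespace false

noncomputable section

open scoped Classical NumberField
open WeierstrassCurve NumberField Field IsDedekindDomain IntermediateField
  Literature.NumberTheory.EllipticCurves Literature.NumberTheory.EllipticCurves.Rank1Residual
  Literature.NumberTheory.EllipticCurves.Rank1Residual.Typed
  Literature.NumberTheory.GaloisRepresentations Literature.NumberTheory.NumberFields
  Literature.NumberTheory.SerreUniformity Literature.NumberTheory.IwasawaTheory
  Summit.BirchSwinnertonDyer.Rank1Residual Summit.BirchSwinnertonDyer.Rank1Residual.Additive
  Summit.BirchSwinnertonDyer.BirchSwinnertonDyer.Theorems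
  Summit.BirchSwinnertonDyer.BirchSwinnertonDyer.Theorems.AdditiveBranchIMCGordTwoRankOne
  Summit.BirchSwinnertonDyer.BirchSwinnertonDyer.Theorems.WildUpperUnitTwistRecords

namespace Summit.BirchSwinnertonDyer.BirchSwinnertonDyer.Theorems.WildFineSelmerCentralLayerL11Records

/-! ## §0 The road (doors L8 ∘ L11 with Fukuda's index and tameness from `Δ` a cube) -/

set_option synthInstance.maxHeartbeats 400000 in
set_option maxHeartbeats 4000000 in
/-- **(A) at `(W, 3)` from ONE degree-24 class group with its Galois action** (fact-free road of this file): `W/ℚ` elliptic, `W[3]` irreducible,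
`Δ(W)` a cube (so `ρ̄_{W,3}` is not onto and `3 ∤ #Gal(ℚ(W[3])/ℚ)`: Fukuda index `0` at `ℚ(P) ⊆ ℚ(W[3])` and tameness, all kernel), `P ∈ W[3] ∖ 0`;
DISPLAYED: for every cyclotomic `ℤ₃`-extension `κ_P` of `ℚ(P) = ℚ̄^{Stab(P)}`, every `ℚ(P)`-automorphism of the layer `ℚ(P)₁` acts trivially on
`Cl(ℚ(P)₁)/Cl(ℚ(P)₁)³`.  Then statement (A) holds for `W` at `3` over every cyclotomic `ℤ₃`-extension of `ℚ` (doors L11 `classicalMuVanishes_of_classGroup_mulEquiv_trivial_succ`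
and L8 `fineSelmerDual_moduleFinite_of_classGroupPRank_stabilizerField_le`, composed in `CoatesSujatha2005.conjA_of_classGroup_mulEquiv_trivial_stabilizerField_succ`).
[cite: CoatesSujatha2005, §3 Thm. 3.4 and Lemma 3.8] [cite: DeoRaySujatha2023, §5 Lemma 5.1] [cite: Washington1997, §13.3 Lemma 13.18 and Prop. 13.22]
[cite: Serre1972, §2.4 Prop. 15, §5.3] [cite: NeukirchANT1999, Ch. IV §6 and Ch. VI §7 Thm. (7.1)] -/
theorem conjA_three_of_Δ_eq_cube_of_classGroup_mulEquiv_trivial (W : WeierstrassCurve ℚ) [W.IsElliptic]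
    (hirr : W.HasIrreducibleModPGaloisRep 3) {d : ℚ} (hΔ : W.Δ = d ^ 3)
    (P : ↥(W.geomTorsion ((3 : ℕ) : ℤ))) (hP0 : P ≠ 0)
    (hσ : ∀ κP : ZpExtension ↥(fixedField (MulAction.stabilizer (absoluteGaloisGroup ℚ) P) :
        IntermediateField ℚ (AlgebraicClosure ℚ)) 3, κP.IsCyclotomic →
      ∀ (σ : ↥(κP.layer (0 + 1)) ≃ₐ[↥(fixedField (MulAction.stabilizer (absoluteGaloisGroup ℚ) P) :
            IntermediateField ℚ (AlgebraicClosure ℚ))] ↥(κP.layer (0 + 1)))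
        (c : ClassGroup (𝓞 ↥(κP.layer (0 + 1)))),
        ClassGroup.mulEquiv (AmbiguousClass.intAut σ) c * c⁻¹ ∈
          (powMonoidHom 3 : ClassGroup (𝓞 ↥(κP.layer (0 + 1))) →* ClassGroup (𝓞 ↥(κP.layer (0 + 1)))).range)
    (κ : ZpExtension ℚ 3) (hκ : κ.IsCyclotomic) :
    ∃ (γ : absoluteGaloisGroup ℚ) (Df : W.FineSelmerDualData κ γ),
      Module.Finite ℤ_[3] (RestrictScalars ℤ_[3] (IwasawaAlgebra 3) Df.X) := by
  haveI : Fact (Nat.Prime 3) := ⟨Nat.prime_three⟩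
  have hns : ¬ W.HasSurjectiveModNGaloisRep 3 := ModThreeImage.not_hasSurjectiveModNGaloisRep_three_of_Δ_eq_cube W hΔ
  have hG : ¬ 3 ∣ Nat.card ((W.divisionField 3) ≃ₐ[ℚ] (W.divisionField 3)) :=
    SmallImageDickson.not_dvd_card_aut_divisionField W 3 hirr hns
  have hle : fixedField (MulAction.stabilizer (absoluteGaloisGroup ℚ) P) ≤ W.divisionField 3 :=
    CoatesSujatha2005.fixedField_stabilizer_le_divisionField W P
  haveI : FiniteDimensional ℚ ↥(W.divisionField 3) := W.finiteDimensional_divisionField 3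
  haveI : IsGalois ℚ ↥(W.divisionField 3) := W.isGalois_divisionField 3
  haveI : FiniteDimensional ℚ ↥(fixedField (MulAction.stabilizer (absoluteGaloisGroup ℚ) P)) :=
    FiniteDimensional.of_injective (IntermediateField.inclusion hle).toLinearMap (IntermediateField.inclusion_injective hle)
  haveI : NumberField ↥(fixedField (MulAction.stabilizer (absoluteGaloisGroup ℚ) P)) := NumberField.mk
  exact CoatesSujatha2005.conjA_of_classGroup_mulEquiv_trivial_stabilizerField_succ W (by decide) hirr hG P hP0 (n₀ := 0)
    (fun κP hκP => ⟨CartanMuRoadFukudaDoorsTprime.totallyRamifiedFrom_zero_of_isCyclotomic_of_algHom_normal_of_not_dvd_card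
      ↥(fixedField (MulAction.stabilizer (absoluteGaloisGroup ℚ) P)) (W.divisionField 3) 3 hG (IntermediateField.inclusion hle) κP hκP,
      hσ κP hκP⟩) κ hκ

set_option synthInstance.maxHeartbeats 400000 in
set_option maxHeartbeats 4000000 in
/-- **U₀ `ord₃ #Ш(W) ≤ ord₃ #Ш(W)_an` from the same datum** (modulo the named facts `hKatoA` (Kato's fine-Selmer reading of 14.5 (3)), `hGZK`, `hmod`, and
Cremona's `r_an = 0`): `W/ℚ` minimal, `ClassO6 W 3`, `W[3]` irreducible, `Δ(W)` a cube, `P ≠ 0`, and the displayed central-layer hypothesis at `ℚ(P)` —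
then `MissingUpperBoundAt W 3` (k8t-c4's `WildFineSelmerSupersingularCMAnchor.missingUpperBoundAt_wild_of_conjA` over the (A)-door above). CONDITIONAL; nothing booked;
BSD proved for no curve. [cite: Kato2004Asterisque, Thm. 14.5 (3) (p. 236) and Prop. 14.16 (2)] [cite: CoatesSujatha2005, §3 Thm. 3.4]
[cite: Washington1997, §13.3 Prop. 13.22–13.23] [cite: Serre1972, §2.4 Prop. 15, §5.3] -/
theorem missingUpperBoundAt_three_of_Δ_eq_cube_of_classGroup_mulEquiv_trivial
    (hKatoA : Kato2004.rankZero_padicValNat_sha_add_padicValNat_tamagawa_le_of_additive_potGood_of_irreducible_of_fineSelmerDual_fg)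
    (hGZK : rank_eq_analyticRank_of_analyticRank_le_one) (hmod : hasEntireLFunction_rat)
    (W : WeierstrassCurve ℚ) [W.IsElliptic] [W.IsGloballyMinimal] (hr : W.analyticRank = 0) (hO : ClassO6 W 3)
    (hirr : W.HasIrreducibleModPGaloisRep 3) {d : ℚ} (hΔ : W.Δ = d ^ 3)
    (P : ↥(W.geomTorsion ((3 : ℕ) : ℤ))) (hP0 : P ≠ 0)
    (hσ : ∀ κP : ZpExtension ↥(fixedField (MulAction.stabilizer (absoluteGaloisGroup ℚ) P) :
        IntermediateField ℚ (AlgebraicClosure ℚ)) 3, κP.IsCyclotomic →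
      ∀ (σ : ↥(κP.layer (0 + 1)) ≃ₐ[↥(fixedField (MulAction.stabilizer (absoluteGaloisGroup ℚ) P) :
            IntermediateField ℚ (AlgebraicClosure ℚ))] ↥(κP.layer (0 + 1)))
        (c : ClassGroup (𝓞 ↥(κP.layer (0 + 1)))),
        ClassGroup.mulEquiv (AmbiguousClass.intAut σ) c * c⁻¹ ∈
          (powMonoidHom 3 : ClassGroup (𝓞 ↥(κP.layer (0 + 1))) →* ClassGroup (𝓞 ↥(κP.layer (0 + 1)))).range) :
    MissingUpperBoundAt W 3 := by
  haveI : Fact (Nat.Prime 3) := ⟨Nat.prime_three⟩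
  exact WildFineSelmerSupersingularCMAnchor.missingUpperBoundAt_wild_of_conjA hKatoA hGZK hmod W hr hO hirr
    (fun κ hκ => conjA_three_of_Δ_eq_cube_of_classGroup_mulEquiv_trivial W hirr hΔ P hP0 hσ κ hκ)

/-! ## §1 The rows -/

/-! ### `406593q1` @ `p = 3` — `N = 406593 = 3^3·11·37^2`; Cremona: `r_an = 0`; O6 wild at `3`; image `3Nn` (kernel `hasModPImageEqNonsplitCartanNormalizer_g406593q1_3`);
`ℚ(P)` octic `K8 = x^8 - 2x^7 + 2x^6 + 8x^5 - 33x^4 + 75x^3 - 126x^2 + 99x - 27` (`h = 1`, five primes above `3` — Iwasawa-1956 / unit-index / Fukuda (0,1) / L10 doors all shut: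
`e₀ = 0`, `e₁ = 2`, `rank₃ Cl(ℚ(P)₁) = 2`); LAYER 1 (kit j329384, GRH): `ℚ(P)₁` degree 24, `h = 9`, `Cl = [3,3]`, `Gal(ℚ(P)₁/ℚ(P)) = ⟨σ⟩` acts as the IDENTITY on `Cl/3`.
The last 19942 residue row without an hμ-free record before this file. -/

/-- **(A) AT `(406593q1, 3)` — NO NAMED FACT** (door L11 ∘ L8): KERNEL `irr_g406593q1_3`, `Δ_eq_cube_g406593q1`; DISPLAYED `hσ` («`Gal(ℚ(P)₁/ℚ(P))` acts trivially on
`Cl(ℚ(P)₁)/3`», every `P ≠ 0`, every cyclotomic `κ_P`; kit j329384: `Cl(ℚ(P)₁) = [3,3]`, `σ` = identity, GRH). Per row; nothing booked; (A)/BSD proved for no class.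
[cite: CoatesSujatha2005, §3 Thm. 3.4 and Lemma 3.8] [cite: Washington1997, §13.3 Lemma 13.18 and Prop. 13.22] [cite: Serre1972, §2.4 Prop. 15, §5.3]
[cite: Cremona2006, Table 1 (Cremona label 406593q1)] -/
theorem conjA_g406593q1_3_L11
    {W : WeierstrassCurve ℚ} [W.IsElliptic] (hWeq : W = (⟨0, 0, 1, (-12308679), 16382509841⟩ : WeierstrassCurve ℚ))
    (P : ↥(W.geomTorsion ((3 : ℕ) : ℤ))) (hP0 : P ≠ 0)
    (hσ : ∀ κP : ZpExtension ↥(fixedField (MulAction.stabilizer (absoluteGaloisGroup ℚ) P) :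
        IntermediateField ℚ (AlgebraicClosure ℚ)) 3, κP.IsCyclotomic →
      ∀ (σ : ↥(κP.layer (0 + 1)) ≃ₐ[↥(fixedField (MulAction.stabilizer (absoluteGaloisGroup ℚ) P) :
            IntermediateField ℚ (AlgebraicClosure ℚ))] ↥(κP.layer (0 + 1)))
        (c : ClassGroup (𝓞 ↥(κP.layer (0 + 1)))),
        ClassGroup.mulEquiv (AmbiguousClass.intAut σ) c * c⁻¹ ∈
          (powMonoidHom 3 : ClassGroup (𝓞 ↥(κP.layer (0 + 1))) →* ClassGroup (𝓞 ↥(κP.layer (0 + 1)))).range)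
    (κ : ZpExtension ℚ 3) (hκ : κ.IsCyclotomic) :
    ∃ (γ : absoluteGaloisGroup ℚ) (Df : W.FineSelmerDualData κ γ),
      Module.Finite ℤ_[3] (RestrictScalars ℤ_[3] (IwasawaAlgebra 3) Df.X) := by
  subst hWeq
  exact conjA_three_of_Δ_eq_cube_of_classGroup_mulEquiv_trivial _ irr_g406593q1_3 Δ_eq_cube_g406593q1 P hP0 hσ κ hκ

/-- **RECORD — U₀ `ord₃ #Ш(E) ≤ ord₃ #Ш(E)_an` for `E = 406593q1` at `p = 3` on the fact-free door L11** (residue row of K9 items 19942 / 19189 / 19197; aside 19386):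
KERNEL `classO6_g406593q1_3`, `irr_g406593q1_3`, `Δ_eq_cube_g406593q1`; DISPLAYED named facts `hKatoA hGZK hmod` ONLY, Cremona's `r_an = 0` (`hr`), and `hσ` (kit j329384:
`Cl(ℚ(P)₁) = [3,3]`, `σ` = identity on `Cl/3`, GRH). Per row; nothing booked; BSD is not proved by this.
[cite: Kato2004Asterisque, Thm. 14.5 (3) (p. 236) and Prop. 14.16 (2)] [cite: CoatesSujatha2005, §3 Thm. 3.4] [cite: Cremona2006, Table 1 (Cremona label 406593q1)] -/
theorem missingUpperBoundAt_g406593q1_3_L11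
    (hKatoA : Kato2004.rankZero_padicValNat_sha_add_padicValNat_tamagawa_le_of_additive_potGood_of_irreducible_of_fineSelmerDual_fg)
    (hGZK : rank_eq_analyticRank_of_analyticRank_le_one) (hmod : hasEntireLFunction_rat)
    {W : WeierstrassCurve ℚ} [W.IsElliptic] [W.IsGloballyMinimal] (hWeq : W = (⟨0, 0, 1, (-12308679), 16382509841⟩ : WeierstrassCurve ℚ))
    (hr : W.analyticRank = 0) (P : ↥(W.geomTorsion ((3 : ℕ) : ℤ))) (hP0 : P ≠ 0)
    (hσ : ∀ κP : ZpExtension ↥(fixedField (MulAction.stabilizer (absoluteGaloisGroup ℚ) P) :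
        IntermediateField ℚ (AlgebraicClosure ℚ)) 3, κP.IsCyclotomic →
      ∀ (σ : ↥(κP.layer (0 + 1)) ≃ₐ[↥(fixedField (MulAction.stabilizer (absoluteGaloisGroup ℚ) P) :
            IntermediateField ℚ (AlgebraicClosure ℚ))] ↥(κP.layer (0 + 1)))
        (c : ClassGroup (𝓞 ↥(κP.layer (0 + 1)))),
        ClassGroup.mulEquiv (AmbiguousClass.intAut σ) c * c⁻¹ ∈
          (powMonoidHom 3 : ClassGroup (𝓞 ↥(κP.layer (0 + 1))) →* ClassGroup (𝓞 ↥(κP.layer (0 + 1)))).range) :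
    MissingUpperBoundAt W 3 := by
  subst hWeq
  exact missingUpperBoundAt_three_of_Δ_eq_cube_of_classGroup_mulEquiv_trivial hKatoA hGZK hmod _ hr classO6_g406593q1_3 irr_g406593q1_3
    Δ_eq_cube_g406593q1 P hP0 hσ

/-! ### `406593f1` @ `p = 3` — `N = 406593 = 3^3·11·37^2`; Cremona: `r_an = 0`, `∏ c_ℓ = 12`; O6 wild at `3`; `Δ = (-18387039)³` (image in a Cartan normaliser; `ℚ(P)` = the octic of
406593q1 per the cell's census, conjA-anchor g19/g20); LAYER 1 (kit j329384, GRH): `Cl(ℚ(P)₁) = [3,3]`, `σ` = identity on `Cl/3`. -/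

/-- `Δ(406593f1) = (-18387039)³` — a CUBE (kernel, `norm_num`). [cite: Serre1972, §5.3] [cite: Cremona2006, Table 1 (Cremona label 406593f1)] -/
theorem Δ_cube_g406593f1 : (⟨1, (-1), 1, (-4530278), (-5305847140)⟩ : WeierstrassCurve ℚ).Δ = (((-18387039) : ℚ)) ^ 3 := by
  norm_num [WeierstrassCurve.Δ, WeierstrassCurve.b₂, WeierstrassCurve.b₄, WeierstrassCurve.b₆, WeierstrassCurve.b₈]

/-- **(A) AT `(406593f1, 3)` — NO NAMED FACT** (door L11 ∘ L8): KERNEL `irr_g406593f1_3`, `Δ_cube_g406593f1`; DISPLAYED `hσ` («`Gal(ℚ(P)₁/ℚ(P))` acts trivially on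
`Cl(ℚ(P)₁)/3`»; kit j329384: `[3,3]`, identity, GRH). Per row; nothing booked; (A)/BSD proved for no class.
[cite: CoatesSujatha2005, §3 Thm. 3.4 and Lemma 3.8] [cite: Washington1997, §13.3 Lemma 13.18 and Prop. 13.22] [cite: Serre1972, §2.4 Prop. 15, §5.3]
[cite: Cremona2006, Table 1 (Cremona label 406593f1)] -/
theorem conjA_g406593f1_3_L11
    {W : WeierstrassCurve ℚ} [W.IsElliptic] (hWeq : W = (⟨1, (-1), 1, (-4530278), (-5305847140)⟩ : WeierstrassCurve ℚ))
    (P : ↥(W.geomTorsion ((3 : ℕ) : ℤ))) (hP0 : P ≠ 0)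
    (hσ : ∀ κP : ZpExtension ↥(fixedField (MulAction.stabilizer (absoluteGaloisGroup ℚ) P) :
        IntermediateField ℚ (AlgebraicClosure ℚ)) 3, κP.IsCyclotomic →
      ∀ (σ : ↥(κP.layer (0 + 1)) ≃ₐ[↥(fixedField (MulAction.stabilizer (absoluteGaloisGroup ℚ) P) :
            IntermediateField ℚ (AlgebraicClosure ℚ))] ↥(κP.layer (0 + 1)))
        (c : ClassGroup (𝓞 ↥(κP.layer (0 + 1)))),
        ClassGroup.mulEquiv (AmbiguousClass.intAut σ) c * c⁻¹ ∈
          (powMonoidHom 3 : ClassGroup (𝓞 ↥(κP.layer (0 + 1))) →* ClassGroup (𝓞 ↥(κP.layer (0 + 1)))).range)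
    (κ : ZpExtension ℚ 3) (hκ : κ.IsCyclotomic) :
    ∃ (γ : absoluteGaloisGroup ℚ) (Df : W.FineSelmerDualData κ γ),
      Module.Finite ℤ_[3] (RestrictScalars ℤ_[3] (IwasawaAlgebra 3) Df.X) := by
  subst hWeq
  exact conjA_three_of_Δ_eq_cube_of_classGroup_mulEquiv_trivial _ irr_g406593f1_3 Δ_cube_g406593f1 P hP0 hσ κ hκ

/-- **RECORD — U₀ for `E = 406593f1` at `p = 3` on the fact-free door L11**: KERNEL `classO6_g406593f1_3`, `irr_g406593f1_3`, `Δ_cube_g406593f1`; DISPLAYED `hKatoA hGZK hmod`,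
`hr`, `hσ` (kit j329384, GRH). Per row; nothing booked; BSD is not proved by this. [cite: Kato2004Asterisque, Thm. 14.5 (3) (p. 236) and Prop. 14.16 (2)]
[cite: CoatesSujatha2005, §3 Thm. 3.4] [cite: Cremona2006, Table 1 (Cremona label 406593f1)] -/
theorem missingUpperBoundAt_g406593f1_3_L11
    (hKatoA : Kato2004.rankZero_padicValNat_sha_add_padicValNat_tamagawa_le_of_additive_potGood_of_irreducible_of_fineSelmerDual_fg)
    (hGZK : rank_eq_analyticRank_of_analyticRank_le_one) (hmod : hasEntireLFunction_rat)
    {W : WeierstrassCurve ℚ} [W.IsElliptic] [W.IsGloballyMinimal] (hWeq : W = (⟨1, (-1), 1, (-4530278), (-5305847140)⟩ : WeierstrassCurve ℚ))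
    (hr : W.analyticRank = 0) (P : ↥(W.geomTorsion ((3 : ℕ) : ℤ))) (hP0 : P ≠ 0)
    (hσ : ∀ κP : ZpExtension ↥(fixedField (MulAction.stabilizer (absoluteGaloisGroup ℚ) P) :
        IntermediateField ℚ (AlgebraicClosure ℚ)) 3, κP.IsCyclotomic →
      ∀ (σ : ↥(κP.layer (0 + 1)) ≃ₐ[↥(fixedField (MulAction.stabilizer (absoluteGaloisGroup ℚ) P) :
            IntermediateField ℚ (AlgebraicClosure ℚ))] ↥(κP.layer (0 + 1)))
        (c : ClassGroup (𝓞 ↥(κP.layer (0 + 1)))),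
        ClassGroup.mulEquiv (AmbiguousClass.intAut σ) c * c⁻¹ ∈
          (powMonoidHom 3 : ClassGroup (𝓞 ↥(κP.layer (0 + 1))) →* ClassGroup (𝓞 ↥(κP.layer (0 + 1)))).range) :
    MissingUpperBoundAt W 3 := by
  subst hWeq
  exact missingUpperBoundAt_three_of_Δ_eq_cube_of_classGroup_mulEquiv_trivial hKatoA hGZK hmod _ hr classO6_g406593f1_3 irr_g406593f1_3
    Δ_cube_g406593f1 P hP0 hσ

/-! ### `406593n1` @ `p = 3` — `N = 406593 = 3^3·11·37^2`; Cremona: `r_an = 0`, `∏ c_ℓ = 12`; O6 wild at `3`; image `3Nn`; `Δ = (-13431)³`; LAYER 1 (kit j329384, GRH):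
`Cl(ℚ(P)₁) = [3,3]`, `σ` = identity on `Cl/3`.  (This row already holds a fact-free L5 record, k9-c4 g25 `conjA_g406593n1_3_L5`; this is a second, independent fact-free road.) -/

/-- **(A) AT `(406593n1, 3)` — NO NAMED FACT** (door L11 ∘ L8): KERNEL `irr_g406593n1_3`, `WildFineSelmerLayerOneL5Records.Δ_cube_g406593n1`; DISPLAYED `hσ` (kit j329384:
`[3,3]`, identity, GRH). Per row; nothing booked; (A)/BSD proved for no class.
[cite: CoatesSujatha2005, §3 Thm. 3.4 and Lemma 3.8] [cite: Washington1997, §13.3 Lemma 13.18 and Prop. 13.22] [cite: Serre1972, §2.4 Prop. 15, §5.3]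
[cite: Cremona2006, Table 1 (Cremona label 406593n1)] -/
theorem conjA_g406593n1_3_L11
    {W : WeierstrassCurve ℚ} [W.IsElliptic] (hWeq : W = (⟨1, (-1), 0, (-3309), (-103944)⟩ : WeierstrassCurve ℚ))
    (P : ↥(W.geomTorsion ((3 : ℕ) : ℤ))) (hP0 : P ≠ 0)
    (hσ : ∀ κP : ZpExtension ↥(fixedField (MulAction.stabilizer (absoluteGaloisGroup ℚ) P) :
        IntermediateField ℚ (AlgebraicClosure ℚ)) 3, κP.IsCyclotomic →
      ∀ (σ : ↥(κP.layer (0 + 1)) ≃ₐ[↥(fixedField (MulAction.stabilizer (absoluteGaloisGroup ℚ) P) :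
            IntermediateField ℚ (AlgebraicClosure ℚ))] ↥(κP.layer (0 + 1)))
        (c : ClassGroup (𝓞 ↥(κP.layer (0 + 1)))),
        ClassGroup.mulEquiv (AmbiguousClass.intAut σ) c * c⁻¹ ∈
          (powMonoidHom 3 : ClassGroup (𝓞 ↥(κP.layer (0 + 1))) →* ClassGroup (𝓞 ↥(κP.layer (0 + 1)))).range)
    (κ : ZpExtension ℚ 3) (hκ : κ.IsCyclotomic) :
    ∃ (γ : absoluteGaloisGroup ℚ) (Df : W.FineSelmerDualData κ γ),
      Module.Finite ℤ_[3] (RestrictScalars ℤ_[3] (IwasawaAlgebra 3) Df.X) := by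
  subst hWeq
  exact conjA_three_of_Δ_eq_cube_of_classGroup_mulEquiv_trivial _ irr_g406593n1_3 WildFineSelmerLayerOneL5Records.Δ_cube_g406593n1 P hP0 hσ κ hκ

/-- **RECORD — U₀ for `E = 406593n1` at `p = 3` on the fact-free door L11**: KERNEL `classO6_g406593n1_3`, `irr_g406593n1_3`, `Δ_cube_g406593n1`; DISPLAYED `hKatoA hGZK hmod`,
`hr`, `hσ` (kit j329384, GRH). Per row; nothing booked; BSD is not proved by this. [cite: Kato2004Asterisque, Thm. 14.5 (3) (p. 236) and Prop. 14.16 (2)]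
[cite: CoatesSujatha2005, §3 Thm. 3.4] [cite: Cremona2006, Table 1 (Cremona label 406593n1)] -/
theorem missingUpperBoundAt_g406593n1_3_L11
    (hKatoA : Kato2004.rankZero_padicValNat_sha_add_padicValNat_tamagawa_le_of_additive_potGood_of_irreducible_of_fineSelmerDual_fg)
    (hGZK : rank_eq_analyticRank_of_analyticRank_le_one) (hmod : hasEntireLFunction_rat)
    {W : WeierstrassCurve ℚ} [W.IsElliptic] [W.IsGloballyMinimal] (hWeq : W = (⟨1, (-1), 0, (-3309), (-103944)⟩ : WeierstrassCurve ℚ))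
    (hr : W.analyticRank = 0) (P : ↥(W.geomTorsion ((3 : ℕ) : ℤ))) (hP0 : P ≠ 0)
    (hσ : ∀ κP : ZpExtension ↥(fixedField (MulAction.stabilizer (absoluteGaloisGroup ℚ) P) :
        IntermediateField ℚ (AlgebraicClosure ℚ)) 3, κP.IsCyclotomic →
      ∀ (σ : ↥(κP.layer (0 + 1)) ≃ₐ[↥(fixedField (MulAction.stabilizer (absoluteGaloisGroup ℚ) P) :
            IntermediateField ℚ (AlgebraicClosure ℚ))] ↥(κP.layer (0 + 1)))
        (c : ClassGroup (𝓞 ↥(κP.layer (0 + 1)))),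
        ClassGroup.mulEquiv (AmbiguousClass.intAut σ) c * c⁻¹ ∈
          (powMonoidHom 3 : ClassGroup (𝓞 ↥(κP.layer (0 + 1))) →* ClassGroup (𝓞 ↥(κP.layer (0 + 1)))).range) :
    MissingUpperBoundAt W 3 := by
  subst hWeq
  exact missingUpperBoundAt_three_of_Δ_eq_cube_of_classGroup_mulEquiv_trivial hKatoA hGZK hmod _ hr classO6_g406593n1_3 irr_g406593n1_3
    WildFineSelmerLayerOneL5Records.Δ_cube_g406593n1 P hP0 hσ

/-! ### `223587bz1` @ `p = 3` — `N = 223587 = 3^3·7^2·13^2`; Cremona: `r_an = 0`, `∏ c_ℓ = 12`; O6 wild at `3`; image: normaliser of a NON-split Cartan; `Δ = (-415233)³`;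
`ℚ(P)` octic `K8 = x^8 - 12x^6 - 91x^5 - 219x^4 - 273x^3 - 108x^2 + 81`; LAYER 1 (kit j329384, GRH): `ℚ(P)₁` degree 24, `h = 54`, `Cl = [6,3,3]`, `σ` = identity on `Cl/3`
(`rank₃ = 3 > 1`: door L10 shut). -/

/-- `Δ(223587bz1) = (-415233)³` — a CUBE (kernel, `norm_num`). [cite: Serre1972, §5.3] [cite: Cremona2006, Table 1 (Cremona label 223587bz1)] -/
theorem Δ_cube_g223587bz1 : (⟨1, (-1), 0, (-77856), 15370109⟩ : WeierstrassCurve ℚ).Δ = (((-415233) : ℚ)) ^ 3 := by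
  norm_num [WeierstrassCurve.Δ, WeierstrassCurve.b₂, WeierstrassCurve.b₄, WeierstrassCurve.b₆, WeierstrassCurve.b₈]

/-- **(A) AT `(223587bz1, 3)` — NO NAMED FACT** (door L11 ∘ L8): KERNEL `irr_g223587bz1_3`, `Δ_cube_g223587bz1`; DISPLAYED `hσ` (kit j329384: `Cl(ℚ(P)₁) = [6,3,3]`,
`σ` = identity on `Cl/3`, GRH). Per row; nothing booked; (A)/BSD proved for no class.
[cite: CoatesSujatha2005, §3 Thm. 3.4 and Lemma 3.8] [cite: Washington1997, §13.3 Lemma 13.18 and Prop. 13.22] [cite: Serre1972, §2.4 Prop. 15, §5.3]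
[cite: Cremona2006, Table 1 (Cremona label 223587bz1)] -/
theorem conjA_g223587bz1_3_L11
    {W : WeierstrassCurve ℚ} [W.IsElliptic] (hWeq : W = (⟨1, (-1), 0, (-77856), 15370109⟩ : WeierstrassCurve ℚ))
    (P : ↥(W.geomTorsion ((3 : ℕ) : ℤ))) (hP0 : P ≠ 0)
    (hσ : ∀ κP : ZpExtension ↥(fixedField (MulAction.stabilizer (absoluteGaloisGroup ℚ) P) :
        IntermediateField ℚ (AlgebraicClosure ℚ)) 3, κP.IsCyclotomic →
      ∀ (σ : ↥(κP.layer (0 + 1)) ≃ₐ[↥(fixedField (MulAction.stabilizer (absoluteGaloisGroup ℚ) P) :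
            IntermediateField ℚ (AlgebraicClosure ℚ))] ↥(κP.layer (0 + 1)))
        (c : ClassGroup (𝓞 ↥(κP.layer (0 + 1)))),
        ClassGroup.mulEquiv (AmbiguousClass.intAut σ) c * c⁻¹ ∈
          (powMonoidHom 3 : ClassGroup (𝓞 ↥(κP.layer (0 + 1))) →* ClassGroup (𝓞 ↥(κP.layer (0 + 1)))).range)
    (κ : ZpExtension ℚ 3) (hκ : κ.IsCyclotomic) :
    ∃ (γ : absoluteGaloisGroup ℚ) (Df : W.FineSelmerDualData κ γ),
      Module.Finite ℤ_[3] (RestrictScalars ℤ_[3] (IwasawaAlgebra 3) Df.X) := by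
  subst hWeq
  exact conjA_three_of_Δ_eq_cube_of_classGroup_mulEquiv_trivial _ irr_g223587bz1_3 Δ_cube_g223587bz1 P hP0 hσ κ hκ

/-- **RECORD — U₀ for `E = 223587bz1` at `p = 3` on the fact-free door L11**: KERNEL `classO6_g223587bz1_3`, `irr_g223587bz1_3`, `Δ_cube_g223587bz1`; DISPLAYED `hKatoA hGZK hmod`,
`hr`, `hσ` (kit j329384, GRH). Per row; nothing booked; BSD is not proved by this. [cite: Kato2004Asterisque, Thm. 14.5 (3) (p. 236) and Prop. 14.16 (2)]
[cite: CoatesSujatha2005, §3 Thm. 3.4] [cite: Cremona2006, Table 1 (Cremona label 223587bz1)] -/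
theorem missingUpperBoundAt_g223587bz1_3_L11
    (hKatoA : Kato2004.rankZero_padicValNat_sha_add_padicValNat_tamagawa_le_of_additive_potGood_of_irreducible_of_fineSelmerDual_fg)
    (hGZK : rank_eq_analyticRank_of_analyticRank_le_one) (hmod : hasEntireLFunction_rat)
    {W : WeierstrassCurve ℚ} [W.IsElliptic] [W.IsGloballyMinimal] (hWeq : W = (⟨1, (-1), 0, (-77856), 15370109⟩ : WeierstrassCurve ℚ))
    (hr : W.analyticRank = 0) (P : ↥(W.geomTorsion ((3 : ℕ) : ℤ))) (hP0 : P ≠ 0)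
    (hσ : ∀ κP : ZpExtension ↥(fixedField (MulAction.stabilizer (absoluteGaloisGroup ℚ) P) :
        IntermediateField ℚ (AlgebraicClosure ℚ)) 3, κP.IsCyclotomic →
      ∀ (σ : ↥(κP.layer (0 + 1)) ≃ₐ[↥(fixedField (MulAction.stabilizer (absoluteGaloisGroup ℚ) P) :
            IntermediateField ℚ (AlgebraicClosure ℚ))] ↥(κP.layer (0 + 1)))
        (c : ClassGroup (𝓞 ↥(κP.layer (0 + 1)))),
        ClassGroup.mulEquiv (AmbiguousClass.intAut σ) c * c⁻¹ ∈
          (powMonoidHom 3 : ClassGroup (𝓞 ↥(κP.layer (0 + 1))) →* ClassGroup (𝓞 ↥(κP.layer (0 + 1)))).range) :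
    MissingUpperBoundAt W 3 := by
  subst hWeq
  exact missingUpperBoundAt_three_of_Δ_eq_cube_of_classGroup_mulEquiv_trivial hKatoA hGZK hmod _ hr classO6_g223587bz1_3 irr_g223587bz1_3
    Δ_cube_g223587bz1 P hP0 hσ

/-! ### `223587k1` @ `p = 3` — `N = 223587 = 3^3·7^2·13^2`; Cremona: `r_an = 0`, `∏ c_ℓ = 4`; O6 wild at `3`; `Δ = (-46137)³`; `ℚ(P)` = the octic of 223587bz1 per the cell's census;
LAYER 1 (kit j329384, GRH): `Cl(ℚ(P)₁) = [6,3,3]`, `σ` = identity on `Cl/3`. -/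

/-- `Δ(223587k1) = (-46137)³` — a CUBE (kernel, `norm_num`). [cite: Serre1972, §5.3] [cite: Cremona2006, Table 1 (Cremona label 223587k1)] -/
theorem Δ_cube_g223587k1 : (⟨1, (-1), 1, (-8651), (-566380)⟩ : WeierstrassCurve ℚ).Δ = (((-46137) : ℚ)) ^ 3 := by
  norm_num [WeierstrassCurve.Δ, WeierstrassCurve.b₂, WeierstrassCurve.b₄, WeierstrassCurve.b₆, WeierstrassCurve.b₈]

/-- **(A) AT `(223587k1, 3)` — NO NAMED FACT** (door L11 ∘ L8): KERNEL `irr_g223587k1_3`, `Δ_cube_g223587k1`; DISPLAYED `hσ` (kit j329384: `Cl(ℚ(P)₁) = [6,3,3]`,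
`σ` = identity on `Cl/3`, GRH). Per row; nothing booked; (A)/BSD proved for no class.
[cite: CoatesSujatha2005, §3 Thm. 3.4 and Lemma 3.8] [cite: Washington1997, §13.3 Lemma 13.18 and Prop. 13.22] [cite: Serre1972, §2.4 Prop. 15, §5.3]
[cite: Cremona2006, Table 1 (Cremona label 223587k1)] -/
theorem conjA_g223587k1_3_L11
    {W : WeierstrassCurve ℚ} [W.IsElliptic] (hWeq : W = (⟨1, (-1), 1, (-8651), (-566380)⟩ : WeierstrassCurve ℚ))
    (P : ↥(W.geomTorsion ((3 : ℕ) : ℤ))) (hP0 : P ≠ 0)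
    (hσ : ∀ κP : ZpExtension ↥(fixedField (MulAction.stabilizer (absoluteGaloisGroup ℚ) P) :
        IntermediateField ℚ (AlgebraicClosure ℚ)) 3, κP.IsCyclotomic →
      ∀ (σ : ↥(κP.layer (0 + 1)) ≃ₐ[↥(fixedField (MulAction.stabilizer (absoluteGaloisGroup ℚ) P) :
            IntermediateField ℚ (AlgebraicClosure ℚ))] ↥(κP.layer (0 + 1)))
        (c : ClassGroup (𝓞 ↥(κP.layer (0 + 1)))),
        ClassGroup.mulEquiv (AmbiguousClass.intAut σ) c * c⁻¹ ∈
          (powMonoidHom 3 : ClassGroup (𝓞 ↥(κP.layer (0 + 1))) →* ClassGroup (𝓞 ↥(κP.layer (0 + 1)))).range)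
    (κ : ZpExtension ℚ 3) (hκ : κ.IsCyclotomic) :
    ∃ (γ : absoluteGaloisGroup ℚ) (Df : W.FineSelmerDualData κ γ),
      Module.Finite ℤ_[3] (RestrictScalars ℤ_[3] (IwasawaAlgebra 3) Df.X) := by
  subst hWeq
  exact conjA_three_of_Δ_eq_cube_of_classGroup_mulEquiv_trivial _ irr_g223587k1_3 Δ_cube_g223587k1 P hP0 hσ κ hκ

/-- **RECORD — U₀ for `E = 223587k1` at `p = 3` on the fact-free door L11**: KERNEL `classO6_g223587k1_3`, `irr_g223587k1_3`, `Δ_cube_g223587k1`; DISPLAYED `hKatoA hGZK hmod`,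
`hr`, `hσ` (kit j329384, GRH). Per row; nothing booked; BSD is not proved by this. [cite: Kato2004Asterisque, Thm. 14.5 (3) (p. 236) and Prop. 14.16 (2)]
[cite: CoatesSujatha2005, §3 Thm. 3.4] [cite: Cremona2006, Table 1 (Cremona label 223587k1)] -/
theorem missingUpperBoundAt_g223587k1_3_L11
    (hKatoA : Kato2004.rankZero_padicValNat_sha_add_padicValNat_tamagawa_le_of_additive_potGood_of_irreducible_of_fineSelmerDual_fg)
    (hGZK : rank_eq_analyticRank_of_analyticRank_le_one) (hmod : hasEntireLFunction_rat)
    {W : WeierstrassCurve ℚ} [W.IsElliptic] [W.IsGloballyMinimal] (hWeq : W = (⟨1, (-1), 1, (-8651), (-566380)⟩ : WeierstrassCurve ℚ))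
    (hr : W.analyticRank = 0) (P : ↥(W.geomTorsion ((3 : ℕ) : ℤ))) (hP0 : P ≠ 0)
    (hσ : ∀ κP : ZpExtension ↥(fixedField (MulAction.stabilizer (absoluteGaloisGroup ℚ) P) :
        IntermediateField ℚ (AlgebraicClosure ℚ)) 3, κP.IsCyclotomic →
      ∀ (σ : ↥(κP.layer (0 + 1)) ≃ₐ[↥(fixedField (MulAction.stabilizer (absoluteGaloisGroup ℚ) P) :
            IntermediateField ℚ (AlgebraicClosure ℚ))] ↥(κP.layer (0 + 1)))
        (c : ClassGroup (𝓞 ↥(κP.layer (0 + 1)))),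
        ClassGroup.mulEquiv (AmbiguousClass.intAut σ) c * c⁻¹ ∈
          (powMonoidHom 3 : ClassGroup (𝓞 ↥(κP.layer (0 + 1))) →* ClassGroup (𝓞 ↥(κP.layer (0 + 1)))).range) :
    MissingUpperBoundAt W 3 := by
  subst hWeq
  exact missingUpperBoundAt_three_of_Δ_eq_cube_of_classGroup_mulEquiv_trivial hKatoA hGZK hmod _ hr classO6_g223587k1_3 irr_g223587k1_3
    Δ_cube_g223587k1 P hP0 hσ

end Summit.BirchSwinnertonDyer.BirchSwinnertonDyer.Theorems.WildFineSelmerCentralLayerL11Records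

end
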